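import Summits.SmoothPoincare4.SmoothPoincare4.Theses.EntropyRung
import Summits.SmoothPoincare4.SmoothPoincare4.Theses.WeylBudget
import Summits.SmoothPoincare4.SmoothPoincare4.Theorems.EntropyRungChangGurskyYangOfClassicalFacts
import Literature.Geometry.Riemannian.ChernGaussBonnetFourProofs
import Literature.Geometry.Riemannian.ChangGurskyYangPIC
import Literature.Geometry.Riemannian.ChangGurskyYangSpectral
import Literature.Geometry.Riemannian.PICSphereLeaves
import HarnessLib

/-!
# Crux `EntropyRung.ChangGurskyYang` (item stmt-SmoothPoincare4-10834): the remaining debt after the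
# Chern–Gauss–Bonnet formula became a THEOREM of the tree — two renderings, kernel-checked

The crux is VERBATIM the named fact `changGurskyYang_sphere_four` (Chang–Gursky–Yang 2003, Thm. A,
simply connected `scal > 0` case; `changGurskyYang_iff_sphere_four` below, `Iff.rfl`). The lead
assembly `EntropyRungChangGurskyYangOfClassicalFacts.lean` (line `margerin-cone-hamilton-rails`)
closed it MODULO three classical named facts: `chernGaussBonnet_four`, `changGurskyYang_theorem14_four`
(CGY 2003 Thm. 1.4, `α = 1`, connected) and `hamilton_convergenceCriterion_four` (Hamilton 1986 §5.2).
The first of these is now PROVED in the tree — `chernGaussBonnet_four_holds`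
(`Literature/Geometry/Riemannian/ChernGaussBonnetFourProofs.lean`: Chern's intrinsic vector-field
proof over a Morse function, axioms `propext`/`Classical.choice`/`Quot.sound`). This file records what
is left, in the two renderings the tree now supports:

* **Margerin line** (`ChangGurskyYang_of_theorem14_of_convergenceCriterion`): the crux from the TWO
  facts `changGurskyYang_theorem14_four` and `hamilton_convergenceCriterion_four` — the registered
  stubs `stub_thm14Psc` / `stub_pinchedFlowConvergence` of the skeleton (STUBS 1–3 proved, STUB 5 =
  Chern–Gauss–Bonnet discharged here);
* **PIC line** (`ChangGurskyYang_of_picSphere`): the crux from the SINGLE named fact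
  `hamilton_pic_sphere_four` (Hamilton 1997, Cor. 1.2(a), completed by Chen–Zhu 2006: a closed simply
  connected PIC 4-manifold is `≅ S⁴`), through the tree's eigenvalue-crossing assembly
  `changGurskyYang_sphere_four_of_pic_of_chernGaussBonnetFormula` (`ChangGurskyYangSpectral.lean`:
  Chen–Zhu 2014's conformal PIC theorem is PROVED there, `chenZhu2014_conformal_pic_four_holds`, and the
  Schrödinger ground state `exists_pos_groundState`) whose only other hypothesis was the
  Chern–Gauss–Bonnet formula over closed simply connected 4-manifolds — a special case of
  `chernGaussBonnet_four_holds`; equivalently (`ChangGurskyYang_of_surgicalStep_of_cerf`) from the two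
  decomposition leaves of that fact, `chenZhu_surgicalStep_admissibleRestart` (Chen–Zhu 2006, §5, the
  surgery step) and `cerf_pi0DiffDisc_relBoundary_three` (Cerf 1968, `Γ₄ = 0`), via
  `hamilton_pic_sphere_four_holds_of` (`PICSphereLeaves.lean`);
* `ChangGurskyYang_of_either` — either debt set suffices;
* **why the PIC fact also subsumes Margerin's leaf for `π₁ = 1`**
  (`hasPositiveIsotropicCurvature_of_weakPinching_lt`, `margerin_sphere_of_picSphere`): `R > 0` and weak
  pinching `WP = (|W|² + 2|E|²)/R² < 1/6` pointwise give `6|W|² < R²`, hence by the tree's pointwise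
  inequality `(R − 3K_iso(e))² ≤ 6|W|²` (`sq_scalarCurvature_sub_three_mul_isotropicCurvature_le`,
  Chen–Zhu 2014 §1 with Hamilton 1997 §1.2) every isotropic curvature is positive — so a closed simply
  connected `(M⁴, g)` with `R > 0`, `WP < 1/6` is PIC and `hamilton_pic_sphere_four` alone gives
  `M ≅ S⁴` (Margerin 1998, Thm. 1 in the simply connected case; the borderline `WP ≡ 1/6` models `ℂP²`,
  `S³ × ℝ` are exactly the non-strict PIC cases).

Everything here is PROVED (no `sorry`, no new definition, no new named fact); the theorems taking a
named fact as hypothesis are CONDITIONAL closings of the item (the gate records conditional results;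
the item closes when `hamilton_pic_sphere_four`, or both `changGurskyYang_theorem14_four` and
`hamilton_convergenceCriterion_four`, are discharged).

References: [ChangGurskyYang2003] Thm. A, (1.1), §2; [Hamilton1997] Cor. 1.2(a); [ChenZhu2006]
Thm. 1.1; [ChenZhu2014] §1 p. 4, Cor. 2.2; [Margerin1998] Thm. 1; [Hamilton1986] §5, 5.2;
[Besse1987] 6.31; [Chern1944]; [CerfDiffeoSphere1968] Ch. I §2.
-/

noncomputable section

-- every `Summit.SmoothPoincare4.SmoothPoincare4.…` name repeats the summit = sub-problem segment (D-0017 layout)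
set_option linter.dupNamespace false

open Set Function Module
open scoped Manifold ContDiff Topology ENNReal

namespace Summit.SmoothPoincare4.SmoothPoincare4.Theorems.MargerinRails

open Summit.SmoothPoincare4.SmoothPoincare4.Theses.EntropyRung (ChangGurskyYang)
open Literature.Geometry.Riemannian
open Literature.Geometry.Lorentzian Literature.Geometry.Lorentzian.PseudoRiemannianMetric
open Literature.Topology.FourManifolds

/-! ## The crux is the named fact, verbatim -/

/-- The crux `EntropyRung.ChangGurskyYang` is, symbol for symbol, the named fact
`changGurskyYang_sphere_four` (Chang–Gursky–Yang 2003, Thm. A, simply connected `scal > 0` case).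
[cite: ChangGurskyYang2003, Thm. A] -/
theorem changGurskyYang_iff_sphere_four : ChangGurskyYang ↔ changGurskyYang_sphere_four := Iff.rfl

/-! ## Margerin line: Chern–Gauss–Bonnet discharged, two named facts remain -/

/-- **The crux from CGY 2003 Thm. 1.4 and Hamilton 1986 §5.2 only** (line
`margerin-cone-hamilton-rails`): `ChangGurskyYang_of_classicalFacts` with its first hypothesis, the
Chern–Gauss–Bonnet formula in dimension four, supplied by the tree's THEOREM
`chernGaussBonnet_four_holds`. The two remaining hypotheses are exactly the registered stubs
`stub_thm14Psc` (via `stub_thm14Psc_of_theorem14`) and `stub_pinchedFlowConvergence` (via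
`stub_pinchedFlowConvergence_of_convergenceCriterion`) of the skeleton.
[cite: ChangGurskyYang2003, §2, p. 121] [cite: Margerin1998, Thm. 1] [cite: Hamilton1986, §5, 5.2]
[cite: Besse1987, 6.31] -/
theorem ChangGurskyYang_of_theorem14_of_convergenceCriterion :
    changGurskyYang_theorem14_four → hamilton_convergenceCriterion_four → ChangGurskyYang :=
  ChangGurskyYang_of_classicalFacts chernGaussBonnet_four_holds

/-- The same reduction for the item's second route decl `WeylBudget.ChangGurskyYang`.
[cite: ChangGurskyYang2003, Thm. A] -/
theorem ChangGurskyYang_weylBudget_of_theorem14_of_convergenceCriterion :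
    changGurskyYang_theorem14_four → hamilton_convergenceCriterion_four →
      Summit.SmoothPoincare4.SmoothPoincare4.Theses.WeylBudget.ChangGurskyYang :=
  ChangGurskyYang_of_theorem14_of_convergenceCriterion

/-! ## PIC line: the crux from Hamilton's PIC sphere theorem alone -/

/-- **The crux from the single named fact `hamilton_pic_sphere_four`.** The tree's
eigenvalue-crossing assembly `changGurskyYang_sphere_four_of_pic_of_chernGaussBonnetFormula`
(`ChangGurskyYangSpectral.lean`; Chen–Zhu 2014 Cor. 2.2 PROVED there; Schrödinger ground state
PROVED) needs besides `hPIC` only the Chern–Gauss–Bonnet formula (1.1) over closed simply connected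
4-manifolds, which is the special case `π₁ = 1` of the tree's theorem `chernGaussBonnet_four_holds`.
So along this line the crux hinges on ONE published theorem: Hamilton 1997, Cor. 1.2(a) (Ricci flow
with surgery on PIC 4-manifolds, Chen–Zhu 2006). [cite: ChangGurskyYang2003, Thm. A, (1.1) p. 111]
[cite: Hamilton1997, Cor. 1.2(a) (p. 3)] [cite: ChenZhu2014, §1 p. 4, Cor. 2.2] [cite: Chern1944, §1, (9)] -/
theorem ChangGurskyYang_of_picSphere : hamilton_pic_sphere_four → ChangGurskyYang := fun hPIC ↦
  changGurskyYang_iff_sphere_four.mpr <|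
    changGurskyYang_sphere_four_of_pic_of_chernGaussBonnetFormula hPIC
      fun M _ _ _ _ _ _ _ g _ hg ↦ chernGaussBonnet_four_holds M g hg

/-- The same for the item's second route decl `WeylBudget.ChangGurskyYang`.
[cite: ChangGurskyYang2003, Thm. A] [cite: Hamilton1997, Cor. 1.2(a) (p. 3)] -/
theorem ChangGurskyYang_weylBudget_of_picSphere :
    hamilton_pic_sphere_four → Summit.SmoothPoincare4.SmoothPoincare4.Theses.WeylBudget.ChangGurskyYang :=
  ChangGurskyYang_of_picSphere

/-- **The crux from the two decomposition leaves of `hamilton_pic_sphere_four`**: Chen–Zhu's surgery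
step with admissible restart data (`chenZhu_surgicalStep_admissibleRestart`, Chen–Zhu 2006 §5) and
Cerf's `π₀ Diff(D³ rel ∂) = 0` (`cerf_pi0DiffDisc_relBoundary_three`), composed through the tree's
`hamilton_pic_sphere_four_holds_of` (`PICSphereLeaves.lean`). [cite: ChenZhu2006, Thm. 1.1 (p. 3), Thm. 5.6 (p. 43)]
[cite: CerfDiffeoSphere1968, Ch. I §2] [cite: Hamilton1997, Cor. 1.2(a) (p. 3)] -/
theorem ChangGurskyYang_of_surgicalStep_of_cerf (hstep : chenZhu_surgicalStep_admissibleRestart)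
    (hcerf : cerf_pi0DiffDisc_relBoundary_three) : ChangGurskyYang :=
  ChangGurskyYang_of_picSphere (hamilton_pic_sphere_four_holds_of hstep hcerf)

/-- **Either remaining debt set closes the crux**: Hamilton's PIC sphere theorem, OR (CGY 2003
Thm. 1.4 AND Hamilton 1986 §5.2). [cite: ChangGurskyYang2003, Thm. A] [cite: Hamilton1997, Cor. 1.2(a) (p. 3)]
[cite: Hamilton1986, §5, 5.2] -/
theorem ChangGurskyYang_of_either
    (h : hamilton_pic_sphere_four ∨
      (changGurskyYang_theorem14_four ∧ hamilton_convergenceCriterion_four)) : ChangGurskyYang :=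
  h.elim ChangGurskyYang_of_picSphere
    fun h' ↦ ChangGurskyYang_of_theorem14_of_convergenceCriterion h'.1 h'.2

/-! ## Weak pinching below `1/6` is positive isotropic curvature -/

/-- **`R > 0` and `WP < 1/6` pointwise imply positive isotropic curvature** on a smooth 4-manifold
(any `C^∞` metric carrying a Levi-Civita connection; no compactness). From `WP = (|W|² + 2|E|²)/R²
< 1/6` and `|E|² ≥ 0` one gets `6|W|² < R²`; the tree's frame inequality
`(R − 3K_iso(e))² ≤ 6|W|²` (`sq_scalarCurvature_sub_three_mul_isotropicCurvature_le`: `R − 3K(e) =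
3Å₁₁(e)` and `Å₁₁² ≤ (2/3)‖Å‖² ≤ (2/3)|W|²`, Chen–Zhu 2014 §1 with Hamilton 1997 §1.2) then gives
`(R − 3K)² < R²`, i.e. `0 < K < 2R/3`, on every orthonormal 4-frame; all Levi-Civita connections of
`g` have the same curvature (`IsLeviCivita.curvature_eq_riemann`). The constant `1/6` is sharp for
this implication too: `(ℂP², g_FS)` and `S³ × ℝ` have `WP ≡ 1/6` and a vanishing isotropic curvature
on some frame / are the rigid models. [cite: ChenZhu2014, §1, p. 4] [cite: Hamilton1997, §1.2, p. 5]
[cite: Margerin1998, Part I, p. 25] -/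
theorem hasPositiveIsotropicCurvature_of_weakPinching_lt
    {M : Type*} [TopologicalSpace M] [ChartedSpace (EuclideanSpace ℝ (Fin 4)) M]
    [IsManifold (𝓡 4) ∞ M]
    (g : PseudoRiemannianMetric (𝓡 4) ∞ (EuclideanSpace ℝ (Fin 4)) (TangentSpace (𝓡 4) : M → Type _))
    [g.HasLeviCivita] (hR : ∀ x, 0 < g.scalarCurvature x) (hWP : ∀ x, g.weakPinching x < 1 / 6) :
    g.HasPositiveIsotropicCurvature := by
  intro cov hcov x e he
  have hn : (2 : ℕ∞ω) ≤ ((⊤ : ℕ∞) : ℕ∞ω) := WithTop.coe_le_coe.mpr le_top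
  have hE : finrank ℝ (EuclideanSpace ℝ (Fin 4)) = 4 := finrank_euclideanSpace_fin
  -- every Levi-Civita connection of `g` has the curvature of `g.leviCivita`
  have hfun : g.curvatureForm cov x = g.curvatureForm g.leviCivita x := by
    funext X Y Z W
    simp only [curvatureForm, hcov.curvature_eq_riemann hn x]
    rfl
  have hiso : g.isotropicCurvature cov x e = g.isotropicCurvature g.leviCivita x e := by
    simp only [isotropicCurvature, hfun]
  rw [hiso]
  -- `(R − 3K)² ≤ 6|W|²`
  have key := sq_scalarCurvature_sub_three_mul_isotropicCurvature_le g hn hE he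
  -- `6|W|² < R²` from `WP < 1/6`, `R > 0`, `|E|² ≥ 0`
  have hRx := hR x
  have hW6 : 6 * g.weylNormSq x < g.scalarCurvature x ^ 2 := by
    have h := hWP x
    rw [weakPinching, div_lt_iff₀ (by positivity)] at h
    have hEn := g.tracelessRicciNormSq_nonneg x
    nlinarith
  -- `(R − 3K)² < R²` with `R > 0` forces `K > 0`
  nlinarith [key, hW6, sq_nonneg (g.isotropicCurvature g.leviCivita x e)]

/-- **Margerin's theorem in the simply connected case from Hamilton's PIC sphere theorem**: GIVEN the
named fact `hamilton_pic_sphere_four`, a closed simply connected smooth 4-manifold carrying a `C^∞`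
Riemannian metric with `R > 0` and `WP < 1/6` pointwise is diffeomorphic to `S⁴`
(`hasPositiveIsotropicCurvature_of_weakPinching_lt`). This is why, for the crux (which spends
`π₁ = 1` anyway), Hamilton's Cor. 1.2(a) dominates the pair (Margerin 1998 Thm. 1 = STUBS 1–4 of the
line, Hamilton 1986 §5.2): the Ricci-flow convergence endgame `hamilton_convergenceCriterion_four` is
only needed for the `ℝP⁴` alternative / non-simply-connected `M`. [cite: Margerin1998, Thm. 1 (p. 21)]
[cite: Hamilton1997, Cor. 1.2(a) (p. 3)] -/
theorem margerin_sphere_of_picSphere (hPIC : hamilton_pic_sphere_four)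
    (M : Type) [TopologicalSpace M] [T2Space M] [SecondCountableTopology M]
    [ChartedSpace (EuclideanSpace ℝ (Fin 4)) M] [IsManifold (𝓡 4) ∞ M] [CompactSpace M]
    [SimplyConnectedSpace M]
    (g : PseudoRiemannianMetric (𝓡 4) ∞ (EuclideanSpace ℝ (Fin 4)) (TangentSpace (𝓡 4) : M → Type _))
    [g.HasLeviCivita] (hg : g.IsRiemannian) (hR : ∀ x, 0 < g.scalarCurvature x)
    (hWP : ∀ x, g.weakPinching x < 1 / 6) :
    Nonempty (M ≃ₘ⟮𝓡 4, 𝓡 4⟯ Metric.sphere (0 : EuclideanSpace ℝ (Fin 5)) 1) :=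
  hPIC M ⟨g, hg, hasPositiveIsotropicCurvature_of_weakPinching_lt g hR hWP⟩

/-- **The crux from CGY 2003 Thm. 1.4 and Hamilton's PIC sphere theorem** — the Margerin line with its
Ricci-flow endgame (STUB 4) replaced by `hamilton_pic_sphere_four` through
`margerin_sphere_of_picSphere`: Chern–Gauss–Bonnet (PROVED) and `χ ≥ 2` give (1.2), Thm. 1.4 gives a
conformal metric with `R > 0`, `¼|W|² < σ₂(A)` pointwise, hence `WP < 1/6` (PROVED rearrangement), hence
PIC, hence `S⁴`. (Logically dominated by `ChangGurskyYang_of_picSphere`; recorded because it is the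
line's own composition with one leaf swapped.) [cite: ChangGurskyYang2003, §2, p. 121]
[cite: Hamilton1997, Cor. 1.2(a) (p. 3)] -/
theorem ChangGurskyYang_of_theorem14_of_picSphere :
    changGurskyYang_theorem14_four → hamilton_pic_sphere_four → ChangGurskyYang := by
  intro h14 hPIC
  rintro M _ _ _ _ _ _ _ ⟨g, _, hgR, hscal, hW⟩
  letI : MeasurableSpace M := borel M
  haveI : BorelSpace M := ⟨rfl⟩
  have hE : finrank ℝ (EuclideanSpace ℝ (Fin 4)) = 4 := finrank_euclideanSpace_fin
  -- (0.3) ⇒ (1.2): Chern–Gauss–Bonnet (PROVED) and `χ(M) ≥ 2`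
  have h12 : 1 / 4 * g.weylEnergy.toReal < g.sigma2WeylSchoutenIntegral :=
    quarter_weylEnergy_lt_of_chernGaussBonnet g hgR (chernGaussBonnet_four_holds M g hgR) hW
  -- Thm. 1.4, connected psc shape (STUB 6 modulo the fact)
  obtain ⟨g', _, hg'R, -, hscal', hpt⟩ := stub_thm14Psc_of_theorem14 h14 M g hgR hscal h12
  have hpos' : ∀ (x : M) (v : TangentSpace (𝓡 4) x), v ≠ 0 → 0 < g'.val x v v :=
    fun x v hv ↦ hg'R x v hv
  -- "rearranging terms": `WP < 1/6` pointwise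
  have hWP : ∀ x, g'.weakPinching x < 1 / 6 := fun x ↦
    g'.weakPinching_lt_of_sigma2WeylSchouten_gt (WithTop.coe_le_coe.mpr le_top) hE (hpos' x) (hpt x)
  exact margerin_sphere_of_picSphere hPIC M g' hg'R hscal' hWP

end Summit.SmoothPoincare4.SmoothPoincare4.Theorems.MargerinRails

end
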